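import Summits.Ventures.PercRepro.RankLevelSetBiIndepAvoidSkew
import Summits.Ventures.PercRepro.RankLevelSetBiIndepContainCum

/-! # RankLevelSetBiIndepContainLC — LOG-CONCAVE CONTAIN PROFILES ARE UNIMODAL; (CX) FOLLOWS FROM (CX*) AND UNIMODALITY;
HENCE THE CUMULATIVE LADDER NEEDS ONLY (CX*) AND LOG-CONCAVITY ON THE MINORS (night-1 g30; dossier §42.17)

`BiContainLC M` (a `Prop`, NOT asserted) is log-concavity of every contain profile `α^X` — the consequence of the
Lorentzian theorem of the published literature for the polynomial `Σ_k α^X_k w^{#E−k} w'^k` (dossier §35.10 / §42.17: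
`f̃_M(v,w)·f̃_M(v',w')`, the derivatives `∂_{v_e}` (`e ∈ X`) and `∂_{v_e} + ∂_{v'_e}` (`e ∉ X`) at `v = v' = 0`; the
statement is cited, not proved here). The support of a contain profile is an interval (**`biContainCount_pos_of_pos_of_pos`**:
augmentation of a bi-independent set from a larger one keeps bi-independence, the complement only shrinks), so a
log-concave contain profile is unimodal (**`biContainUnimodal_of_LC`**: once it decreases it keeps decreasing). The
reflection (CX*) and unimodality give the consecutive (CX) (**`biContainMono_of_skew_unimodal`**: for `2(k+1) ≤ #E`,
`α_{k+1} ≥ min(α_k, α_{#E−1−k}) = α_k`), so the cumulative (CX*) on every contain-set follows from (CX*) and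
unimodality alone (**`minorPairSkew_contain_of_skew_unimodal`**) and the cumulative ladder closes from (CX*) and
log-concavity on every minor (**`biIndepMono_of_forall_minor_skew_LC`**): modulo the Lorentzian theorem, the residue of
C-025 is the reflection (CX*) on the minors. Nothing here asserts (CX*) or (LC); every declaration has a docstring;
imports: the cell's own modules and Mathlib only. Axioms: standard. -/

namespace PercRepro

open Set Matroid

variable {α : Type} (M : Matroid α) [M.Finite]

omit [M.Finite] in
/-- **(LC), log-concavity of the contain profiles** (a `Prop`, NOT asserted; the consequence of the named Lorentzian
fact, §35.10 / §42.17): `α^X_k · α^X_{k+2} ≤ (α^X_{k+1})²` for every `X ⊆ E` and every `k`. -/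
def BiContainLC : Prop :=
  ∀ X ⊆ M.E, ∀ k : ℕ, biContainCount M X k * biContainCount M X (k + 2) ≤ biContainCount M X (k + 1) ^ 2

/-- **Augmentation keeps bi-independence**: a bi-independent `i`-set extends by an element of a bi-independent
`j`-set (`i < j`) to a bi-independent `(i+1)`-set (the complement only shrinks). -/
lemma exists_insert_mem_biIndep {i j : ℕ} {Z W : Set α} (hZ : Z ∈ biIndep M i) (hW : W ∈ biIndep M j)
    (hij : i < j) : ∃ e ∈ W \ Z, insert e Z ∈ biIndep M (i + 1) := by
  obtain ⟨hZE, hZc, hZi, hZc'⟩ := hZ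
  obtain ⟨hWE, hWc, hWi, -⟩ := hW
  have hZfin : Z.Finite := M.ground_finite.subset hZE
  have hWfin : W.Finite := M.ground_finite.subset hWE
  have hlt : Z.encard < W.encard := by
    rw [← hZfin.cast_ncard_eq, ← hWfin.cast_ncard_eq, hZc, hWc]
    exact_mod_cast hij
  obtain ⟨e, he, hind⟩ := hZi.exists_insert_of_encard_lt hWi hlt
  refine ⟨e, he, Set.insert_subset (hWE he.1) hZE, ?_, hind, ?_⟩
  · rw [Set.ncard_insert_of_notMem he.2 hZfin, hZc]
  · exact hZc'.subset fun x hx => ⟨hx.1, fun h => hx.2 (Set.mem_insert_of_mem e h)⟩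

/-- **The support of a contain profile is an interval**: `α^X_i > 0` and `α^X_k > 0` with `i ≤ j ≤ k` give `α^X_j > 0`. -/
lemma biContainCount_pos_of_pos_of_pos {X : Set α} {i j k : ℕ} (hij : i ≤ j) (hjk : j ≤ k)
    (hi : 0 < biContainCount M X i) (hk : 0 < biContainCount M X k) : 0 < biContainCount M X j := by
  obtain ⟨m, rfl⟩ := Nat.exists_eq_add_of_le hij
  induction m with
  | zero => simpa using hi
  | succ m ih =>
    have hpos := ih (by omega) (by omega)
    unfold biContainCount at hpos hk ⊢
    rw [Set.ncard_pos ((biIndep_finite M _).subset fun _ h => h.1)] at hpos hk ⊢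
    obtain ⟨Z, hZ, hXZ⟩ := hpos
    obtain ⟨W, hW, -⟩ := hk
    obtain ⟨e, -, hZe⟩ := exists_insert_mem_biIndep M hZ hW (by omega)
    exact ⟨insert e Z, hZe, hXZ.trans (Set.subset_insert e Z)⟩

omit [M.Finite] in
/-- **Once a log-concave contain profile decreases it keeps decreasing** (at a positive value). -/
lemma biContainCount_succ_le_of_LC (h : BiContainLC M) {X : Set α} (hX : X ⊆ M.E) {k : ℕ}
    (hpos : 0 < biContainCount M X (k + 1))
    (hdec : biContainCount M X (k + 1) ≤ biContainCount M X k) :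
    biContainCount M X (k + 2) ≤ biContainCount M X (k + 1) := by
  have hlc := h X hX k
  rw [sq] at hlc
  by_contra hlt
  push Not at hlt
  have h1 : biContainCount M X (k + 1) * biContainCount M X (k + 1) <
      biContainCount M X (k + 1) * biContainCount M X (k + 2) := Nat.mul_lt_mul_of_pos_left hlt hpos
  have h2 : biContainCount M X (k + 1) * biContainCount M X (k + 2) ≤
      biContainCount M X k * biContainCount M X (k + 2) := Nat.mul_le_mul_right _ hdec
  exact absurd (lt_of_lt_of_le h1 (h2.trans hlc)) (lt_irrefl _)

/-- **Log-concave contain profiles are unimodal**: `BiContainLC M → BiContainUnimodal M` (the support is an interval,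
and once the profile decreases it keeps decreasing). -/
theorem biContainUnimodal_of_LC (h : BiContainLC M) : BiContainUnimodal M := by
  intro X hX i j k hij hjk
  rcases Nat.eq_zero_or_pos (biContainCount M X i) with hi | hi
  · rw [hi, Nat.zero_min]
    exact Nat.zero_le _
  rcases Nat.eq_zero_or_pos (biContainCount M X k) with hk | hk
  · rw [hk, Nat.min_zero]
    exact Nat.zero_le _
  have hpos : ∀ t, i ≤ t → t ≤ k → 0 < biContainCount M X t :=
    fun t h1 h2 => biContainCount_pos_of_pos_of_pos M h1 h2 hi hk
  by_cases hmono : ∀ m, i ≤ m → m < j → biContainCount M X m ≤ biContainCount M X (m + 1)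
  · -- nondecreasing on `[i, j]`
    have hchain : ∀ s, i + s ≤ j → biContainCount M X i ≤ biContainCount M X (i + s) := by
      intro s
      induction s with
      | zero => intro _; exact le_rfl
      | succ s ih =>
        intro hs
        rw [← Nat.add_assoc]
        exact (ih (by omega)).trans (hmono (i + s) (by omega) (by omega))
    have := hchain (j - i) (by omega)
    rw [Nat.add_sub_cancel' hij] at this
    exact le_trans (min_le_left _ _) this
  · -- a decrease before `j`: nonincreasing from there on, so `α_k ≤ α_j`
    push Not at hmono
    obtain ⟨m, him, hmj, hlt⟩ := hmono
    have hD : ∀ s, m + s + 1 ≤ k → biContainCount M X (m + s + 1) ≤ biContainCount M X (m + s) := by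
      intro s
      induction s with
      | zero => intro _; simpa using hlt.le
      | succ s ih =>
        intro hs
        rw [← Nat.add_assoc]
        have h1 := ih (by omega)
        have h2 := biContainCount_succ_le_of_LC M h hX (hpos (m + s + 1) (by omega) (by omega)) h1
        exact h2
    have hlast : ∀ s, j + s ≤ k → biContainCount M X (j + s) ≤ biContainCount M X j := by
      intro s
      induction s with
      | zero => intro _; exact le_rfl
      | succ s ih =>
        intro hs
        rw [← Nat.add_assoc]
        have h1 := hD (j + s - m) (by omega)
        rw [Nat.add_sub_cancel' (by omega : m ≤ j + s)] at h1
        exact h1.trans (ih (by omega))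
    have := hlast (k - j) (by omega)
    rw [Nat.add_sub_cancel' hjk] at this
    exact le_trans (min_le_right _ _) this

omit [M.Finite] in
/-- **(CX) from (CX*) and unimodality**: for `2(k+1) ≤ #E`, `α_{k+1} ≥ min(α_k, α_{#E−1−k}) = α_k`. -/
theorem biContainMono_of_skew_unimodal (h1 : BiContainSkew M) (h3 : BiContainUnimodal M) : BiContainMono M := by
  intro X hX k hk
  have h4 := h1 X hX k (by omega)
  have h5 := h3 X hX k (k + 1) (M.E.ncard - 1 - k) (by omega) (by omega)
  rw [min_eq_left h4] at h5
  exact h5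

/-- **The cumulative (CX*) from (CX*) and unimodality alone** (the bridge of `RankLevelSetBiIndepContainCum` without
its (CX) hypothesis). -/
theorem minorPairSkew_contain_of_skew_unimodal (h1 : BiContainSkew M) (h3 : BiContainUnimodal M) :
    ∀ X ⊆ M.E, MinorPairSkew M X ∅ (M.E.ncard - 2 * X.ncard - 1) :=
  minorPairSkew_contain_of_skew_mono_unimodal M h1 (biContainMono_of_skew_unimodal M h1 h3) h3

/-- **The cumulative (CX*) from (CX*) and log-concavity.** -/
theorem minorPairSkew_contain_of_skew_LC (h1 : BiContainSkew M) (h2 : BiContainLC M) :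
    ∀ X ⊆ M.E, MinorPairSkew M X ∅ (M.E.ncard - 2 * X.ncard - 1) :=
  minorPairSkew_contain_of_skew_unimodal M h1 (biContainUnimodal_of_LC M h2)

/-- **Mono from (CX*) and log-concavity on every minor**: modulo the Lorentzian theorem (which gives `BiContainLC` on
every matroid), the residue of C-025 is the reflection (CX*) on the minors. -/
theorem biIndepMono_of_forall_minor_skew_LC
    (h : ∀ N : Matroid α, Matroid.IsMinor N M → BiContainSkew N ∧ BiContainLC N) : BiIndepMono M := by
  refine biIndepMono_of_perElem M (biIndepPerElem_of_cum M fun N hN => ?_)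
  haveI : N.Finite := ⟨M.ground_finite.subset hN.subset⟩
  exact minorPairSkew_contain_of_skew_LC N (h N hN).1 (h N hN).2

end PercRepro
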